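import Summits.CriticalPhenomena.CardyFormulaZ2.Theorems.CardyRotToConfR2SymmetryUpgrade.Negative.SurgFatChord
import Summits.CriticalPhenomena.CardyFormulaZ2.Theorems.CardyRotToConfR2SymmetryUpgrade.Negative.LoadBearing
import Literature.Probability.RandomPlanarGeometry.BrownianLoopMarkedDecomposition
import HarnessLib

/-!
# The fat-germ one-shot surgery of a chordal family: definition
# (crux `CardyRotToConfR2SymmetryUpgrade`, stmt-CriticalPhenomena-0698, line germ-label-transport)

`fatSurgery S : ChordalFamily` — in a Dobrushin domain `(D; a, b)` whose germ at `a` FIRES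
(`Fires D.carrier (D.pt 0)`: both boundary branches at `a` Lebesgue-fat, unique inward half-disc
direction), the law of the straight chord `fireChord D` from `a` to its landing point
`q = firePt D ∈ ∂D`, followed (if `q ≠ b`) by an independent `S`-curve of the crosscut domain
`(fireDom D; q, b)`; the Dirac mass at the chord if `q = b`; and `S D` itself if `D` does not fire.
The prefixing map is `firePrefix D ξ = concatClass (mk (fireChord D)) ξ`.

Main statements: the three unfolding lemmas `fatSurgery_of_not_fires`, `fatSurgery_of_eq`,
`fatSurgery_of_ne`; `continuous_firePrefix`; `isProbabilityMeasure_fatSurgery`; and the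
structure independence `fatSurgery_congr` (the law depends on `D` only through
`(carrier, pt 0, pt 1)`, given that `S` is local), with its ingredients `remainingDomain_congr`,
`fireChord_congr`, `carrier_fireDom_congr`. Negative lane: no Theses statement is asserted.
-/

noncomputable section

open Set Filter Topology Metric MeasureTheory
open scoped unitInterval

namespace Summit.CriticalPhenomena.CardyFormulaZ2.Theorems.CardyRotToConfR2SymmetryUpgrade.Negative

open Literature.Probability.RandomPlanarGeometry Literature.Probability.RandomPlanarGeometry.ChordalFamily
open Literature.Probability.RandomPlanarGeometry.BrownianLoop

/-! ### The prefixing map and the surgery family -/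

/-- Prefixing a curve class by the surgery chord of `D`. [folklore] -/
def firePrefix (D : DobrushinDomain) (ξ : CurveClass ℂ) : CurveClass ℂ :=
  concatClass (CurveClass.mk (fireChord D)) ξ

/-- The prefixing map is continuous. [folklore] -/
theorem continuous_firePrefix (D : DobrushinDomain) : Continuous (firePrefix D) :=
  continuous_concatClass.comp (Continuous.prodMk_right _)

/-- The prefixing map is measurable. [folklore] -/
theorem measurable_firePrefix (D : DobrushinDomain) : Measurable (firePrefix D) :=
  (continuous_firePrefix D).measurable

/-- `firePrefix` on a class `mk ξ`. [folklore] -/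
theorem firePrefix_mk (D : DobrushinDomain) (ξ : Curve ℂ) :
    firePrefix D (CurveClass.mk ξ) = mkCM (concatCM (fireChord D).toContinuousMap ξ.toContinuousMap) := by
  rw [firePrefix, concatClass_mk_mk]

/-- **The fat-germ one-shot surgery** of the chordal family `S`. [folklore] -/
def fatSurgery (S : ChordalFamily) : ChordalFamily := fun D =>
  open scoped Classical in
  if h : Fires D.carrier (D.pt 0) then
    if hq : firePt D = D.pt 1 then Measure.dirac (CurveClass.mk (fireChord D))
    else (S (fireDom h hq)).map (firePrefix D)
  else S D

variable {S : ChordalFamily} {D : DobrushinDomain}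

/-- A non-firing domain keeps the law of `S`. [folklore] -/
theorem fatSurgery_of_not_fires (h : ¬ Fires D.carrier (D.pt 0)) : fatSurgery S D = S D := by
  simp [fatSurgery, h]

/-- A firing domain whose chord lands at `b`: Dirac mass at the chord. [folklore] -/
theorem fatSurgery_of_eq (h : Fires D.carrier (D.pt 0)) (hq : firePt D = D.pt 1) :
    fatSurgery S D = Measure.dirac (CurveClass.mk (fireChord D)) := by
  simp [fatSurgery, h, hq]

/-- A firing domain whose chord lands off `b`: the chord prefixed to an `S`-curve of the crosscut
domain. [folklore] -/
theorem fatSurgery_of_ne (h : Fires D.carrier (D.pt 0)) (hq : firePt D ≠ D.pt 1) :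
    fatSurgery S D = (S (fireDom h hq)).map (firePrefix D) := by
  simp [fatSurgery, h, hq]

/-- The surgery laws are probability measures (if the laws of `S` are). [folklore] -/
theorem isProbabilityMeasure_fatSurgery (hS : S.IsChordal) (D : DobrushinDomain) :
    IsProbabilityMeasure (fatSurgery S D) := by
  by_cases h : Fires D.carrier (D.pt 0)
  · by_cases hq : firePt D = D.pt 1
    · rw [fatSurgery_of_eq h hq]; infer_instance
    · rw [fatSurgery_of_ne h hq]
      haveI := (hS (fireDom h hq)).1
      exact Measure.isProbabilityMeasure_map (measurable_firePrefix D).aemeasurable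
  · rw [fatSurgery_of_not_fires h]; exact (hS D).1

/-! ### Structure independence: only `(carrier, pt 0, pt 1)` matter -/

section Congr

variable {D' : DobrushinDomain}

/-- The typed remaining domain depends on `D` only through `(carrier, pt 1)`. [folklore] -/
theorem remainingDomain_congr (hc : D.carrier = D'.carrier) (h1 : D.pt 1 = D'.pt 1)
    (p : CurveClass ℂ) : remainingDomain D p = remainingDomain D' p := by
  simp only [remainingDomain, hc, h1]

/-- The auxiliary point depends only on `(carrier, pt 0)`. [folklore] -/
theorem fireTip_congr (hc : D.carrier = D'.carrier) (h0 : D.pt 0 = D'.pt 0) : fireTip D = fireTip D' := by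
  rw [fireTip, fireTip, hc, h0]

/-- The chord length depends only on `(carrier, pt 0)`. [folklore] -/
theorem fireExit_congr (hc : D.carrier = D'.carrier) (h0 : D.pt 0 = D'.pt 0) : fireExit D = fireExit D' := by
  rw [fireExit, fireExit, fireTip_congr hc h0, hc, h0]

/-- The landing point depends only on `(carrier, pt 0)`. [folklore] -/
theorem firePt_congr (hc : D.carrier = D'.carrier) (h0 : D.pt 0 = D'.pt 0) : firePt D = firePt D' := by
  rw [firePt, firePt, fireTip_congr hc h0, fireExit_congr hc h0, h0]

/-- The chord depends only on `(carrier, pt 0)`. [folklore] -/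
theorem fireChord_congr (hc : D.carrier = D'.carrier) (h0 : D.pt 0 = D'.pt 0) : fireChord D = fireChord D' := by
  rw [fireChord, fireChord, fireTip_congr hc h0, fireExit_congr hc h0, h0]

/-- The prefixing map depends only on `(carrier, pt 0)`. [folklore] -/
theorem firePrefix_congr (hc : D.carrier = D'.carrier) (h0 : D.pt 0 = D'.pt 0) : firePrefix D = firePrefix D' := by
  funext ξ; rw [firePrefix, firePrefix, fireChord_congr hc h0]

/-- The carrier of the crosscut domain depends only on `(carrier, pt 0, pt 1)`. [folklore] -/
theorem carrier_fireDom_congr (hc : D.carrier = D'.carrier) (h0 : D.pt 0 = D'.pt 0) (h1 : D.pt 1 = D'.pt 1)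
    (h : Fires D.carrier (D.pt 0)) (hq : firePt D ≠ D.pt 1)
    (h' : Fires D'.carrier (D'.pt 0)) (hq' : firePt D' ≠ D'.pt 1) :
    (fireDom h hq).carrier = (fireDom h' hq').carrier := by
  rw [← remainingDomain_fireChord h hq, ← remainingDomain_fireChord h' hq', fireChord_congr hc h0,
    remainingDomain_congr hc h1]

/-- **The surgery law depends on `D` only through `(carrier, pt 0, pt 1)`** (for local `S`).
[folklore] -/
theorem fatSurgery_congr (hS : S.IsLocal) (hc : D.carrier = D'.carrier) (h0 : D.pt 0 = D'.pt 0)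
    (h1 : D.pt 1 = D'.pt 1) : fatSurgery S D = fatSurgery S D' := by
  by_cases h : Fires D.carrier (D.pt 0)
  · have h' : Fires D'.carrier (D'.pt 0) := by rwa [← hc, ← h0]
    by_cases hq : firePt D = D.pt 1
    · have hq' : firePt D' = D'.pt 1 := by rwa [← firePt_congr hc h0, ← h1]
      rw [fatSurgery_of_eq h hq, fatSurgery_of_eq h' hq', fireChord_congr hc h0]
    · have hq' : firePt D' ≠ D'.pt 1 := by rwa [← firePt_congr hc h0, ← h1]
      rw [fatSurgery_of_ne h hq, fatSurgery_of_ne h' hq', firePrefix_congr hc h0]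
      congr 1
      exact eq_of_isLocal_of_carrier_eq hS (carrier_fireDom_congr hc h0 h1 h hq h' hq')
        (by rw [pt_zero_fireDom, pt_zero_fireDom, firePt_congr hc h0])
        (by rw [pt_one_fireDom, pt_one_fireDom, h1])
  · have h' : ¬ Fires D'.carrier (D'.pt 0) := by rwa [← hc, ← h0]
    rw [fatSurgery_of_not_fires h, fatSurgery_of_not_fires h']
    exact eq_of_isLocal_of_carrier_eq hS hc h0 h1

end Congr

/-! ### What surgery curves look like -/

/-- The class of the full surgery chord. [folklore] -/
def fireChordClass (D : DobrushinDomain) : CurveClass ℂ := CurveClass.mk (fireChord D)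

/-- The trace of the chord class is the segment `[a, q]`. [folklore] -/
theorem range_fireChordClass (D : DobrushinDomain) :
    (fireChordClass D).range = segment ℝ (D.pt 0) (firePt D) := by
  rw [fireChordClass, CurveClass.range_mk, range_fireChord]

/-- Source of a prefixed class: `a`. [folklore] -/
theorem source_firePrefix (D : DobrushinDomain) (ξ : CurveClass ℂ) : (firePrefix D ξ).source = D.pt 0 := by
  obtain ⟨c, rfl⟩ := CurveClass.surjective_mk ξ
  rw [firePrefix_mk, mkCM, CurveClass.source_mk, Curve.source_def]
  show concatCM (fireChord D).toContinuousMap c.toContinuousMap 0 = D.pt 0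
  rw [concatCM_zero]
  exact source_fireChord

/-- Target of a prefixed class with matching junction: the target of the suffix. [folklore] -/
theorem target_firePrefix (D : DobrushinDomain) {ξ : CurveClass ℂ} (hξ : ξ.source = firePt D) :
    (firePrefix D ξ).target = ξ.target := by
  obtain ⟨c, rfl⟩ := CurveClass.surjective_mk ξ
  rw [CurveClass.source_mk] at hξ
  have hab : (fireChord D).toContinuousMap 1 = c.toContinuousMap 0 := by
    show (fireChord D).target = c.source
    rw [target_fireChord, hξ]
  rw [firePrefix_mk, mkCM, CurveClass.target_mk, CurveClass.target_mk, Curve.target_def, Curve.target_def]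
  exact concatCM_one hab

/-- Trace of a prefixed class with matching junction: chord ∪ trace of the suffix. [folklore] -/
theorem range_firePrefix (D : DobrushinDomain) {ξ : CurveClass ℂ} (hξ : ξ.source = firePt D) :
    (firePrefix D ξ).range = segment ℝ (D.pt 0) (firePt D) ∪ ξ.range := by
  obtain ⟨c, rfl⟩ := CurveClass.surjective_mk ξ
  rw [CurveClass.source_mk] at hξ
  have hab : (fireChord D).toContinuousMap 1 = c.toContinuousMap 0 := by
    show (fireChord D).target = c.source
    rw [target_fireChord, hξ]
  rw [firePrefix_mk, mkCM, CurveClass.range_mk, CurveClass.range_mk, ← range_fireChord]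
  exact range_concatCM hab

end Summit.CriticalPhenomena.CardyFormulaZ2.Theorems.CardyRotToConfR2SymmetryUpgrade.Negative

end
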